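import Literature.Computability.Cryptography.CsidhActionTransitiveProofs
import Literature.Computability.Cryptography.CsidhStartingCurve
import Literature.NumberTheory.EllipticCurves.IsogenyDualFiniteFieldProofs
import Literature.NumberTheory.EllipticCurves.IsogenyCompProofs
import HarnessLib

/-!
# The CSIDH class-group action theorem is equivalent to "the valid curves form one `𝔽_p`-isogeny class"

Sibling *proofs* file (theorems only, D-0014/D-0026; no definition, no named fact) of
`Literature.Computability.Cryptography.CsidhAction`, recording the outcome of the review of the
named fact `csidh_classGroupAction` (Castryck–Lange–Martindale–Panny–Renes, *CSIDH*, ASIACRYPT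
2018, §3 Thm. 7 with Lemma 6, §5 Prop. 8; after Waterhouse 1969 Thm. 4.5 / Schoof 1987 Thm. 4.5)
as machine-checked statements:

* `isIsogenous_of_csidh_classGroupAction` — the fact implies that any two valid Montgomery curves
  `E_{A₀}, E_{A₁}` over `𝔽_p` (`p ≡ 3 (mod 8)`, `p ≥ 5`) are `𝔽_p`-isogenous (clause (3) gives a
  label `f` with `act p f A₀ = A₁`, and `E_{A₀} → E_{act f A₀}` is an `𝔽_p`-isogeny with kernel
  `E_{A₀}[𝔞_f]`, `exists_isogeny_act`);
* `csidh_classGroupAction_iff_isogenous` — together with the tree's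
  `csidh_classGroupAction_of_isogenous` (`CsidhActionTransitiveProofs`: clauses (1), (2), freeness
  and "every `𝔽_p`-isogeny between valid curves is an `act`" are theorems), **the named fact is
  equivalent, over the tree, to the statement that the valid curves over `𝔽_p` are pairwise
  `𝔽_p`-isogenous**;
* `csidh_classGroupAction_iff_isogenous_zero` — equivalently (isogeny of elliptic curves over a
  finite field being symmetric and transitive: `IsIsogenous.symm_of_finite`, `Isogeny.comp`), to
  the statement that **every valid curve `E_A` is `𝔽_p`-isogenous to the CSIDH starting curve
  `E₀ : y² = x³ + x`** (`isCoeff_zero`), i.e. that `Ell_p(ℤ[π], π)` is the `𝔽_p`-isogeny class of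
  `E₀`;
* `csidh_classGroupAction_of_isIsogenous_iff_card_zero` — hence the fact follows from the
  instances `(E₀, E_A)`, `A` valid, of Tate's isogeny theorem in point-count form (the tree's named
  fact `Literature.AlgebraicGeometry.Motives.isIsogenous_iff_card_point_eq`, Tate 1966 Thm. 1),
  both curves having `p + 1` points.

This is exactly where the paper's proof draws on the theory of abelian varieties over finite
fields: Thm. 7 is quoted from Waterhouse (Thm. 4.5, free and transitive action on the curves with
endomorphism ring `𝒪` *within an isogeny class*), and the identification of `Ell_p(ℤ[π], π)` —
defined (§1.2) by the endomorphism ring and the Frobenius, equivalently (§4, Prop. 8) "the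
supersingular curves over `𝔽_p`, which have exactly `p + 1` rational points", in Montgomery form —
with a single `𝔽_p`-isogeny class is Tate's theorem [72 of the paper]. No proof of this isogeny
existence avoiding Tate's theorem (or Deuring's lifting / the Deuring–Eichler count of
supersingular curves) is known; the tree reduces Tate's theorem to the abelian-variety trunk
(`Motives/FaltingsECCardFrontierProofs`).

## References

* [CastryckEtAl2018] W. Castryck, T. Lange, C. Martindale, L. Panny, J. Renes, *CSIDH: an
  efficient post-quantum commutative group action*, ASIACRYPT 2018, LNCS 11274, §1.2 (definition
  of `Ell_p(𝒪, π)`), §3 Lemma 6 and Thm. 7, §4 ("for `p ≥ 5` any supersingular elliptic curve over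
  `𝔽_p` has exactly `p + 1` rational points"; `E₀ : y² = x³ + x`), §5 Prop. 8
  (held: `paper:doi-10-1007-978-3-030-03332-3-15`, text pp. 6, 8, 10, 11).
* [Waterhouse1969] W. C. Waterhouse, *Abelian varieties over finite fields*, Ann. Sci. ÉNS (4) 2
  (1969), Thm. 4.5.
* [Tate1966Endomorphisms] J. Tate, *Endomorphisms of abelian varieties over finite fields*,
  Invent. Math. 2 (1966), §3 Thm. 1.
* [SilvermanAEC2009] J. H. Silverman, *The Arithmetic of Elliptic Curves*, 2nd ed., Thm. III.6.1
  (dual isogeny: isogeny is symmetric), III.4 (composition).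

## Design

`noncomputable section`; theorems only, each a short composition of theorems of the imported
files; no definition and no new named fact (D-0026).
-/

noncomputable section

namespace Literature.Computability.Cryptography.Csidh

open Literature.NumberTheory.QuadraticFields.Quadratic
open Literature.NumberTheory.QuadraticFields.Quadratic.BinQF
open WeierstrassCurve

/-- **The CSIDH theorem makes any two valid curves `𝔽_p`-isogenous**: under
`csidh_classGroupAction`, for `p ≡ 3 (mod 8)`, `p ≥ 5` and valid `A₀, A₁` there is an
`𝔽_p`-isogeny `E_{A₀} → E_{A₁}` (transitivity, clause (3), gives a label `f` with
`act p f A₀ = A₁`; the action is by the `𝔽_p`-isogeny with kernel `E_{A₀}[𝔞_f]`, clause (1)).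
[cite: CastryckEtAl2018, §3 Thm. 7] -/
theorem isIsogenous_of_csidh_classGroupAction (h : csidh_classGroupAction) {p : ℕ} [Fact p.Prime]
    (hp8 : p % 8 = 3) (hp5 : 5 ≤ p) {A₀ A₁ : ZMod p} (h₀ : IsCoeff p A₀) (h₁ : IsCoeff p A₁) :
    (curve p A₀).IsIsogenous (curve p A₁) := by
  obtain ⟨f, ⟨hf, hfA⟩, -⟩ := existsUnique_isLabel_act_eq h hp8 hp5 h₀ h₁
  obtain ⟨φ, -⟩ := exists_isogeny_act h hp8 hp5 hf h₀
  subst hfA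
  exact ⟨φ⟩

/-- **`csidh_classGroupAction` ⟺ the valid curves are pairwise `𝔽_p`-isogenous.** The named fact
(CSIDH Thm. 7 with Lemma 6 and Prop. 8, read on Montgomery coefficients) holds if and only if,
for every prime `p ≡ 3 (mod 8)`, `p ≥ 5`, any two valid curves `E_{A₀}, E_{A₁}` over `𝔽_p` are
`𝔽_p`-isogenous: `→` is `isIsogenous_of_csidh_classGroupAction`, `←` is the tree's
`csidh_classGroupAction_of_isogenous` (every `𝔽_p`-isogeny between valid curves is an `act`).
The right-hand side is the instance of Tate's isogeny theorem used by the paper (§4: the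
supersingular curves over `𝔽_p` are "the curves with `p + 1` points").
[cite: CastryckEtAl2018, §3 Thm. 7 and §4] [cite: Tate1966Endomorphisms, Thm. 1] -/
theorem csidh_classGroupAction_iff_isogenous :
    csidh_classGroupAction ↔
      ∀ (p : ℕ) [Fact p.Prime], p % 8 = 3 → 5 ≤ p → ∀ A₀ A₁ : ZMod p,
        IsCoeff p A₀ → IsCoeff p A₁ → (curve p A₀).IsIsogenous (curve p A₁) :=
  ⟨fun h _ _ hp8 hp5 _ _ h₀ h₁ ↦ isIsogenous_of_csidh_classGroupAction h hp8 hp5 h₀ h₁,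
    csidh_classGroupAction_of_isogenous⟩

/-- **`csidh_classGroupAction` from: every valid curve is `𝔽_p`-isogenous to `E₀ : y² = x³ + x`.**
`E₀` is valid (`isCoeff_zero`, CSIDH §4), isogeny of elliptic curves over the finite field `𝔽_p`
is symmetric (dual isogeny, `IsIsogenous.symm_of_finite`) and transitive (`Isogeny.comp`), so
`E_{A₀} → E₀ → E_{A₁}` is an `𝔽_p`-isogeny between any two valid curves and
`csidh_classGroupAction_of_isogenous` applies.
[cite: CastryckEtAl2018, §3 Thm. 7 and §4] [cite: SilvermanAEC2009, Thm. III.6.1] -/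
theorem csidh_classGroupAction_of_isogenous_zero
    (hiso : ∀ (p : ℕ) [Fact p.Prime], p % 8 = 3 → 5 ≤ p → ∀ A : ZMod p,
      IsCoeff p A → (curve p 0).IsIsogenous (curve p A)) :
    csidh_classGroupAction :=
  csidh_classGroupAction_of_isogenous fun p _ hp8 hp5 A₀ A₁ h₀ h₁ ↦ by
    haveI : NeZero p := ⟨(Fact.out : p.Prime).ne_zero⟩
    haveI := isElliptic_of_isCoeff hp8 h₀
    haveI := isElliptic_of_isCoeff hp8 h₁
    haveI := isElliptic_of_isCoeff hp8 (isCoeff_zero p (by omega))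
    obtain ⟨φ₀⟩ := (hiso p hp8 hp5 A₀ h₀).symm_of_finite
    obtain ⟨φ₁⟩ := hiso p hp8 hp5 A₁ h₁
    exact ⟨φ₁.comp φ₀⟩

/-- **`csidh_classGroupAction` ⟺ every valid curve is `𝔽_p`-isogenous to `E₀ : y² = x³ + x`**,
i.e. (for `p ≡ 3 (mod 8)`, `p ≥ 5`) `Ell_p(ℤ[π], π)`, the set of valid Montgomery curves
(Prop. 8), is the `𝔽_p`-isogeny class of the CSIDH starting curve `E₀` (§4).
[cite: CastryckEtAl2018, §3 Thm. 7, §4, §5 Prop. 8] -/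
theorem csidh_classGroupAction_iff_isogenous_zero :
    csidh_classGroupAction ↔
      ∀ (p : ℕ) [Fact p.Prime], p % 8 = 3 → 5 ≤ p → ∀ A : ZMod p,
        IsCoeff p A → (curve p 0).IsIsogenous (curve p A) :=
  ⟨fun h p _ hp8 hp5 _ hA ↦
      isIsogenous_of_csidh_classGroupAction h hp8 hp5 (isCoeff_zero p (by omega)) hA,
    csidh_classGroupAction_of_isogenous_zero⟩

/-- **`csidh_classGroupAction` from the instances `(E₀, E_A)` of Tate's isogeny theorem** (the
tree's named fact `Literature.AlgebraicGeometry.Motives.isIsogenous_iff_card_point_eq`, Tate 1966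
Thm. 1, in point-count form): for `p ≡ 3 (mod 8)`, `p ≥ 5` and `A` valid, both `E₀` and `E_A`
have `p + 1` rational points (`IsCoeff`), so they are `𝔽_p`-isogenous, and
`csidh_classGroupAction_of_isogenous_zero` applies. This pins the single input of the CSIDH
theorem that the tree does not prove to the pairs `(E₀, E_A)`.
[cite: CastryckEtAl2018, §3 Thm. 7 and §4] [cite: Tate1966Endomorphisms, Thm. 1] -/
theorem csidh_classGroupAction_of_isIsogenous_iff_card_zero
    (htate : ∀ (p : ℕ) [Fact p.Prime], p % 8 = 3 → 5 ≤ p → ∀ A : ZMod p, IsCoeff p A →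
      Literature.AlgebraicGeometry.Motives.isIsogenous_iff_card_point_eq
        (W := curve p 0) (W' := curve p A)) :
    csidh_classGroupAction :=
  csidh_classGroupAction_of_isogenous_zero fun p _ hp8 hp5 A hA ↦ by
    haveI : NeZero p := ⟨(Fact.out : p.Prime).ne_zero⟩
    have h₀ : IsCoeff p 0 := isCoeff_zero p (by omega)
    haveI := isElliptic_of_isCoeff hp8 h₀
    haveI := isElliptic_of_isCoeff hp8 hA
    exact (htate p hp8 hp5 A hA).2 (by rw [h₀.2, hA.2])

end Literature.Computability.Cryptography.Csidh
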